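import Summits.QuantumFields.YangMills.Theorems.UnitScaleTiltHalvingHStokesRow
import Summits.QuantumFields.YangMills.Theorems.UnitScaleTiltHalvingHStokesRowClosureWindows
import Summits.QuantumFields.YangMills.Theorems.UnitScaleTiltHalvingHStokesRowClosureTheta
import Summits.QuantumFields.YangMills.Theorems.UnitScaleTiltHalvingP1FlatCoreCubeInclusion
import Summits.QuantumFields.YangMills.Theorems.UnitScaleTiltProp8FlatMinimizerH
import HarnessLib

/-!
# Line H (`BirthV10.stub_halvingStep`, stmt-QuantumFields-19200) — σ-EDITION (LEAD-H ★w5-19200 g7 WORDS 23∕24, pen (σ9)): THE CLOSURE OF THE (b)-ROW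
# ★★★ `hStokesL_holds : <the displayed hypothesis `hStokesL` of the σ packs `…HMemberPackBaseOfStokesRowS` ∕ `…StepOfStokesRowS` VERBATIM>` — NO HYPOTHESIS

Cell `ym3-torus` (HUMAN RULING D-0037: YM₃ on T³ is ladder rung R3 — NOT d = 4, NOT infinite volume, NOT a mass gap, NOT the Clay problem), width seat `ym3-torus-px20` gen 5.
`--supports stmt-QuantumFields-19200 --as helper`; THEOREMS ONLY (0 `def`, 0 `sorry`); count-neutral.  ONE decl-local `maxHeartbeats 400000` on the ★★★ (its 42-line statement alone
costs > 100k heartbeats to elaborate; README heartbeat rule).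

WHAT.  The σ packs display ONE row, `hStokesL` := the (M2′) assembly's guarded Stokes row (b) ∀-closed over the ρ5 member prefix (`∀ L` odd `> 1`, `∀ (B₀ B₀'H B₂' BG BR cB9) > 0∕≥ 0`,
`∃ (Cθ : ℝ) (sx ρ₅ : ℕ)`, `∀ M′ ≥ 1`, the member letters `F n K ρ S M ρ′ a₅ Cr ε₀ ε₁`, the window `hw`, the room row, `V U x₀ t a α₁ α₄ cstar s`, then the ∀-tail with the chart guard
`c' ≤ 2 * ((F.P K).L * cstar)` of ★★OWNER RULING №21, ending in `‖axialT(…) − 1‖ ≤ d·L·α₁∕8`).  Here it is PROVED with no hypothesis: choice `Cθ := 4`, `sx := 0`, `ρ₅ := 0`; per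
member `ha` from `a = block − t`, `hroomW` from the room row (✓`room_of_level_k`), the master smallness `10^21·L^6·X₀²·(n′s′) ≤ 1` from `hw` (✓`master_of_hw`), the knit's
scalar windows from ✓`knit_windows` ∕ `window_A_knit` ∕ ✓`R_small` ∕ ✓`hstar_le` ∕ ✓`csigma_le` ∕ ✓`wstar_le` ∕ ✓`thetaG_le_of_sigma` ∕ ✓`theta_budget` (the θ-budget of 19200 evidence #47:
`θG = O(s′²)` at `cσ := 2·(L·c⋆)`, `54s′ + 4s′ + 114s′ ≤ 222s′ ≤ dLα₁∕8`), `αω := ε₀`, and then px15 g4's member knit σ ✓p703714 `HalvingHStokesRow.hStokes_holds` (the B-al-3 door σ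
✓p702635 over LEMMA B-al-2 ✓p698270, (R-P) ✓p699568, (B-al-4)₃ σ ✓p702515 `hG_of_rows_σ` ∘ (F-h) ✓p700244 ∘ (F-ω) σ ✓p702542 ∘ level data ✓p703345 ∘ E-sequence ✓p700342∕✓p700741).
CONSUMERS: LEAD-H's (σ8) K-final σ `HalvingHSupURho5OfStokesRowS.hSupUρ5_of_stokesRowS hStokesL_holds hStokesL_holds : hSupUρ5` (the two displayed slots are this text twice),
then the ρ5 room∕door of record ⇒ the registered `BirthV10.stub_halvingStep` ((σ10), ★★OWNER protocol 04:08:54Z).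
HONEST SCOPE.  A composition + real arithmetic; every analytic input is a landed theorem cited by name; nothing here claims the stub, the crux `MinimiserStabilityRegPr`, the rung or the gap.

References: T. Bałaban, CMP **99** (1985) 75–102 [Balaban1985RegularSpaces] (Prop. 3 (1.36)–(1.42) pp.82–83, (1.29) p.81, Thm 4 p.88); CMP **98** (1985) 17–51 [Balaban1985Averaging]
((84)–(86) pp.30–31, Prop. 4 (134)–(144) pp.38–40); CMP **99** (1985) 389–434 [Balaban1985BackgroundPropagators] (Thm 3.1, 3.3); CMP **102** (1985) 277–309 [Balaban1985Variational] ((150)–(156)).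

-/

set_option autoImplicit false
noncomputable section
open scoped BigOperators Matrix.Norms.L2Operator
open NormedSpace open Complex (I)
namespace Summit.QuantumFields.YangMills.Theorems.HalvingHStokesRowClosure
open Literature.MathematicalPhysics.QuantumFieldTheory.Balaban1983to89
open Literature.MathematicalPhysics.QuantumFieldTheory.Balaban1983to89.T3ContinuumYM3Torus
open Literature.MathematicalPhysics.QuantumFieldTheory.Balaban1983to89.T3PrintedRegularMinimiser (RegPr regFibrePr)
open T4Continuum open B5Eq118OneStroke (iterBlockOf) open B7Prop1Explicit (e) open B7Prop1Explicit renaming Site → LSite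
open B7Prop2Explicit (C0 c2' avgIter) open B7Prop4Flat (C2 c4) open B7Eq92Concrete (mgauge) open B8Ineq130 (tlo thi) open B8Ineq132 (covDerivFwd InAk)
open B8Eq119TwistedAxial (Restr129 InAx) open B8Eq131Cubes (cube gs tLo tHi) open B8Eq131CubesAdmissible (cubeFam) open B8CubeMemberZd (cubeLamS)
open B8Eq184Proof (gaugeExp cfgExp) open B8Eq140Level (SideTouches) open B8LambdaSpaceKLevel (wt)
open B10Eq27TorusAxialLog (rel pull unitsField toUField suIncl gaugeActT axialT) open B15Eq112TorusCover (lift) open Node00 (coverAt)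
open Summit.QuantumFields.YangMills.Theorems.Prop8ChartDoubleBar (dbarIterU vframeU) open B8Lemma1NonAbelian (lowPart)
open P1FlatCoreCubeInclusion (room_of_level_k) open Summit.QuantumFields.YangMills.Theorems (FlatMinimizerH.le_T3)
open HalvingHStokesRowClosureWindows (master_of_hw small_of_master smallX_of_master mono_le_one knit_windows R_small)
open HalvingHStokesRowClosureTheta (theta_budget hstar_le csigma_le wstar_le thetaG_le_of_sigma) open HalvingHStokesRow (hStokes_holds)

/-- The knit's L-only window `hA` in ITS parenthesisation — `33·(2·(((d+2)L) + L + 2·(d((L−1)∕2)))) ≤ 20·L^4` at `d = 3`, i.e. `66·(9L−3) ≤ 20L⁴`: equality-tight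
at `L = 3` (`1584 ≤ 1620`, px15 g4), and `594L ≤ 1280L ≤ 20L⁴` for `L ≥ 4` (✓`HalvingHStokesRowClosureWindows.window_A` proves the sibling reading `33·(2((d+2)L) + L + 2(…))`).
[cite: Balaban1985Averaging, Prop. 4 (134)-(135) pp.38-39] -/
theorem window_A_knit (d L : ℕ) (hd : d = 3) (hL : 3 ≤ L) :
    33 * (2 * ((((d + 2) * L : ℕ) : ℝ) + (L : ℝ) + 2 * (((d * ((L - 1) / 2)) : ℕ) : ℝ))) ≤ 20 * (L : ℝ) ^ 4 := by
  subst hd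
  have hL1 : 1 ≤ L := le_trans (by norm_num) hL
  have e5 : (((3 + 2) * L : ℕ) : ℝ) = 5 * (L : ℝ) := by push_cast; ring
  have hhalf : (((3 * ((L - 1) / 2)) : ℕ) : ℝ) ≤ 3 * (((L : ℝ) - 1) / 2) := by
    have h1 : (((L - 1) / 2 : ℕ) : ℝ) ≤ (((L - 1 : ℕ) : ℝ)) / 2 := Nat.cast_div_le
    rw [Nat.cast_sub hL1, Nat.cast_one] at h1
    push_cast; linarith only [h1]
  rw [e5]
  rcases Nat.eq_or_lt_of_le hL with h3 | h4
  · subst h3; norm_num at hhalf ⊢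
  · have hℓ4 : (4 : ℝ) ≤ (L : ℝ) := by exact_mod_cast h4
    have hL4 : 64 * (L : ℝ) ≤ (L : ℝ) ^ 4 := by
      have h3 : (L : ℝ) ^ 3 ≥ 64 := by
        have := pow_le_pow_left₀ (by norm_num : (0:ℝ) ≤ 4) hℓ4 3; norm_num at this; exact this
      nlinarith only [h3, hℓ4]
    nlinarith only [hhalf, hL4, hℓ4]

set_option maxHeartbeats 400000 in
/-- ★★★ **THE (b)-ROW CLOSED: `hStokesL` WITH NO HYPOTHESIS** (σ-letter).  Choice `Cθ := 4`, `sx := 0`, `ρ₅ := 0`; per member: `ha` from `a = block − t`, `hroomW` from the room row,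
the master window from `hw` (✓`master_of_hw`), the knit's scalar windows from ✓`knit_windows` ∕ ✓`window_A` ∕ ✓`theta_budget` ∕ ✓`thetaG_le_of_sigma`, then px15 g4's member knit σ
`HalvingHStokesRow.hStokes_holds`. [cite: Balaban1985RegularSpaces, Prop. 3 (1.42) p.83, Thm 4 p.88; Balaban1985Averaging, (84)-(86) pp.30-31, Prop. 4 pp.38-40] -/
theorem hStokesL_holds :
    ∀ L : ℕ, Odd L → 1 < L → ∀ (B₀ B₀'H B₂' BG BR cB9 : ℝ), 0 < B₀ → 0 < B₀'H → 0 ≤ B₂' → 0 ≤ BG → 0 ≤ BR → 0 < cB9 →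
        -- socket (S9): for EVERY choice of the [4]∕(1.59) constants, the (M2′) window constant `Cθ ≥ 0`, the p.98 letters `sx ρ₅`, ONE `∀ M′` binder, and ONLY the collar residual
        ∃ (Cθ : ℝ) (sx ρ₅ : ℕ), 0 ≤ Cθ ∧ ∀ (M' : ℕ), 1 ≤ M' → L ^ (sx + 1) ∣ M' →
        -- binder (b) «σ-edition» (LEAD-H WORD 24): the (M2′) assembly's guarded STOKES ROW `hStokes` (✓`HalvingH42TopCrossAssemblyR34.h42topCrossT_of_stokes_allS`) at `θb := d·L·α₁∕8`, ∀-closed over the ρ5 member prefix; chart guard `c' ≤ 2·(L·cstar)` — the ONE displayed row; supplier-to-be: ✓p696030 `HalvingHStokesRowOfCombDefect.hStokes_of_rows`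
        (∀ (F : T3Family), F.L = L → ∀ (n K : ℕ) (hnK : n < K) (ρ S M ρ' : ℕ), ρ' = ρ + M + L + S → 1 ≤ M → 2 ≤ S → ∀ (a₅ Cr ε₀ ε₁ : ℝ), 0 < Cr → 4 < Cr → 12 * ((ρ : ℝ) + (M : ℝ)) * a₅ ≤ Cr →
          Cθ * ((((ρ + M + L + S : ℕ) : ℝ) + (M' : ℝ) + 1)) ≤ Cr → L ^ (sx + 1) ∣ ρ + M + L + S → ρ₅ ≤ ρ → 0 < ε₁ → 0 < ε₀ → ε₀ ≤ a₅ → Cr * ε₁ ≤ ε₀ →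
          (10 : ℝ) ^ 29 * (L : ℝ) ^ 12 * (1 + B₀ + B₀⁻¹) ^ 2 * ((1 + B₀'H) * (1 + B₂') * (1 + BG) * (1 + BR)) ^ 5 * (1 + cB9⁻¹) * ((((ρ + M + L + S : ℕ) : ℝ) + (M' : ℝ) + 1) ^ 3 * ε₀) ≤ 1 →
          2 * ρ + (M' + 1 + 2 * (M + L + S)) ≤ F.L ^ (F.m + n) → ∀ (V : GaugeField (F.P n) 0 (Matrix.specialUnitaryGroup (Fin 2) ℂ)), PlaqSmall ε₁ V → ∀ U ∈ regFibrePr F n K hnK.le ε₀ V,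
          ∀ (x₀ : Site (F.P K) 0) (t : ℤ), 0 ≤ t → t ≤ (M' : ℤ) - 1 → ∀ (a : LSite (F.P K).d), a = (fun μ => ((iterBlockOf (K - n) x₀ μ).val : ℤ) - t) →
          ∀ (α₁ α₄ cstar : ℝ), α₁ = 198 * (((ρ' : ℝ) + M' + 1) * ε₀) + 27 * (((ρ' : ℝ) + M' + 1) * ε₀) / ((L : ℝ) * B₀) → cstar = 5 * (F.P K).d * (F.P K).L * B₀ * (ε₀ + α₁) →
          α₄ = 8 * (300 * (L : ℝ) * ((3 * (M' + ρ') + 1 : ℕ) : ℝ) * (B₀'H + 15 * (L : ℝ) ^ 2 * BG * BR + 3 * BG * BR * B₂')) * (5 * ((3 : ℕ) : ℝ) * L * B₀) * (ε₀ + α₁) → ∀ (s : ℝ), s = (198 + 12 * (((M' : ℝ) - 1) + 4 * ρ')) * ε₀ →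
          ∀ (gJ : GaugeTransf (F.P K) 0 (Matrix.specialUnitaryGroup (Fin 2) ℂ)) (u₁ : LSite (F.P K).d → (Matrix (Fin 2) (Fin 2) ℂ)ˣ)
          (W : LSite (F.P K).d → Fin (F.P K).d → (Matrix (Fin 2) (Fin 2) ℂ)ˣ) (A : LSite (F.P K).d → Fin (F.P K).d → Matrix (Fin 2) (Fin 2) ℂ) (c₁ c' : ℝ)
          (κf : (Site (F.P K) 0 → Matrix (Fin 2) (Fin 2) ℂ) → (i : ℕ) → GaugeTransf (F.P K) i (Matrix (Fin 2) (Fin 2) ℂ)ˣ) (lam : LSite (F.P K).d → Matrix (Fin 2) (Fin 2) ℂ),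
          InAk (F.P K).L (K - n) (((F.L : ℝ)⁻¹) ^ (K - n)) ε₀ (fun _ => (Set.univ : Set (LSite (F.P K).d))) (pull (unitsField (toUField (GaugeField.gaugeAct gJ U))) 0) →
          (∀ m', m' ≤ K - n → ∀ Λ : ℕ → Set (LSite (F.P K).d), InAx (F.P K).L m' Λ (1 : LSite (F.P K).d → Fin (F.P K).d → (Matrix (Fin 2) (Fin 2) ℂ)ˣ) (pull (unitsField (toUField (GaugeField.gaugeAct gJ U))) 0)) →
          (∀ m', m' ≤ K - n → ∀ (x : LSite (F.P K).d) (ν : Fin (F.P K).d), tlo (F.P K).L (tLo a ρ') m' ≤ x → x + e ν ≤ thi (F.P K).L (tHi a M' ρ') m' →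
          ‖((avgIter (F.P K).L (pull (unitsField (toUField (GaugeField.gaugeAct gJ U))) 0) (K - n - m') x ν : (Matrix (Fin 2) (Fin 2) ℂ)ˣ) : Matrix (Fin 2) (Fin 2) ℂ) - 1‖ < s) →
          (∀ (x : LSite (F.P K).d) (ν : Fin (F.P K).d), tLo a ρ' ≤ x → x + e ν ≤ tHi a M' ρ' → lowPart ν (x - tLo a ρ') = 0 →
          avgIter (F.P K).L (pull (unitsField (toUField (GaugeField.gaugeAct gJ U))) 0) (K - n) x ν = 1) →
          (∀ z, ((u₁ z : (Matrix (Fin 2) (Fin 2) ℂ)ˣ) : Matrix (Fin 2) (Fin 2) ℂ) ∈ Matrix.specialUnitaryGroup (Fin 2) ℂ) →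
          mgauge (1 : LSite (F.P K).d → Fin (F.P K).d → (Matrix (Fin 2) (Fin 2) ℂ)ˣ) u₁ W = pull (unitsField (toUField (GaugeField.gaugeAct gJ U))) 0 →
          0 ≤ c' → 8 * 3800 * ((((F.P K).d + 2) * (F.P K).L : ℕ) : ℝ) ^ 2 * c' ≤ 1 → c' ≤ 2 * ((F.P K).L * cstar) →
          Real.exp c₁ - 1 ≤ ((F.L : ℝ)⁻¹) ^ (K - n) * c' →
          (∀ z ∈ cube (F.P K).L a M' ρ' (K - n) (K - n), ∀ ν : Fin (F.P K).d, W z ν = cfgExp (((F.L : ℝ)⁻¹) ^ (K - n)) A z ν ∧ ((F.L : ℝ)⁻¹) ^ (K - n) * ‖A z ν‖ ≤ c₁) →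
          (∀ (m : Site (F.P K) 0 → Matrix (Fin 2) (Fin 2) ℂ) (i : ℕ) (y : Site (F.P K) (i + 1)), κf m (i + 1) y = (vframeU (gaugeActT (κf m i) (dbarIterU i (gaugeActT
          (fun s => (u₁ (lift (F.P K) x₀ + rel x₀ s))⁻¹ * Unitary.toUnits (suIncl (gJ s)) : GaugeTransf (F.P K) 0 (Matrix (Fin 2) (Fin 2) ℂ)ˣ)
          (unitsField (toUField U))))) y)⁻¹ * κf m i (emb y) * vframeU (dbarIterU i (gaugeActT
          (fun s => (u₁ (lift (F.P K) x₀ + rel x₀ s))⁻¹ * Unitary.toUnits (suIncl (gJ s)) : GaugeTransf (F.P K) 0 (Matrix (Fin 2) (Fin 2) ℂ)ˣ) (unitsField (toUField U)))) y) →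
          (∀ (m : Site (F.P K) 0 → Matrix (Fin 2) (Fin 2) ℂ) (x : Site (F.P K) 0), ((κf m 0 x : (Matrix (Fin 2) (Fin 2) ℂ)ˣ) : Matrix (Fin 2) (Fin 2) ℂ) = exp (m x)) →
          (∀ x, IsSelfAdjoint (lam x)) → (∀ x, (lam x).trace = 0) → (∀ yc ∈ cubeLamS (F.P K).L a M' ρ' (K - n) (K - n) (K - n),
          κf (((-I) • lam) ∘ fun s : Site (F.P K) 0 => lift (F.P K) x₀ + rel x₀ s) (K - n) (coverAt (F.P K) (K - n) yc) = axialT (dbarIterU (K - n) (gaugeActT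
          (fun s => (u₁ (lift (F.P K) x₀ + rel x₀ s))⁻¹ * Unitary.toUnits (suIncl (gJ s)) : GaugeTransf (F.P K) 0 (Matrix (Fin 2) (Fin 2) ℂ)ˣ)
          (unitsField (toUField U)))) (iterBlockOf (K - n) x₀) (coverAt (F.P K) (K - n) yc)) →
          (∀ j, j ≤ K - n → ∀ b ∈ {b : LSite (F.P K).d × Fin (F.P K).d | SideTouches ((cubeFam false (F.P K).L a M' ρ' (K - n)) j) b.1 b.2},
          ‖lam b.1‖ ≤ α₄ ∧ wt (F.P K).L (((F.L : ℝ)⁻¹) ^ (K - n)) j * ‖covDerivFwd (((F.L : ℝ)⁻¹) ^ (K - n)) (1 : LSite (F.P K).d → Fin (F.P K).d → (Matrix (Fin 2) (Fin 2) ℂ)ˣ) b.2 lam b.1‖ ≤ α₄) →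
          Restr129 (F.P K).L (K - n) (cubeLamS (F.P K).L a M' ρ' (K - n) (K - n)) (1 : LSite (F.P K).d → Fin (F.P K).d → (Matrix (Fin 2) (Fin 2) ℂ)ˣ) u₁ →
          Restr129 (F.P K).L (K - n) (Function.update (cubeLamS (F.P K).L a M' ρ' (K - n) (K - n)) (K - n) ∅) (1 : LSite (F.P K).d → Fin (F.P K).d → (Matrix (Fin 2) (Fin 2) ℂ)ˣ) (u₁ * gaugeExp lam) →
          ∀ yc ∈ cubeLamS (F.P K).L a M' ρ' (K - n) (K - n) (K - n),
          ‖((axialT (dbarIterU (K - n) (gaugeActT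
          (fun s => (u₁ (lift (F.P K) x₀ + rel x₀ s))⁻¹ * Unitary.toUnits (suIncl (gJ s)) : GaugeTransf (F.P K) 0 (Matrix (Fin 2) (Fin 2) ℂ)ˣ)
          (unitsField (toUField U)))) (iterBlockOf (K - n) x₀) (coverAt (F.P K) (K - n) yc) : (Matrix (Fin 2) (Fin 2) ℂ)ˣ) : Matrix (Fin 2) (Fin 2) ℂ) - 1‖ ≤ (((F.P K).d : ℝ) * (F.P K).L * α₁ / 8)) := by
  intro L hodd hL B₀ B₀'H B₂' BG BR cB9 hB₀ hB₀'H hB₂' hBG hBR hcB9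
  refine ⟨4, 0, 0, by norm_num, ?_⟩
  intro M' hM' _hdvd F hF n K hnK ρ S M ρ' hρ' hM hS a₅ Cr ε₀ ε₁ hCr hCr4 h12 hCθ hdvdρ hρ₅ hε₁ hε₀ hε₀a hCrε hw hroom V hV U hU x₀ t ht0 htM a ha_def
    α₁ α₄ cstar hα₁ hcstar hα₄ s hs
  -- LETTERS
  subst hρ'
  have hd3 : (F.P K).d = 3 := T3Family.P_d F K
  have hd3r : ((F.P K).d : ℝ) = 3 := by rw [hd3]; norm_num
  have hLF : (F.P K).L = F.L := rfl
  have hL3 : 3 ≤ L := by obtain ⟨t, ht⟩ := hodd; omega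
  have hL3P : 3 ≤ (F.P K).L := by rw [hLF, hF]; exact hL3
  have hL1P : 1 ≤ (F.P K).L := le_trans (by norm_num) hL3P
  have hLr : ((F.P K).L : ℝ) = (L : ℝ) := by rw [hLF, hF]
  have hℓ3 : (3 : ℝ) ≤ ((F.P K).L : ℝ) := by exact_mod_cast hL3P
  have hℓ1 : (1 : ℝ) ≤ ((F.P K).L : ℝ) := by linarith only [hℓ3]
  have hℓ0 : (0 : ℝ) ≤ ((F.P K).L : ℝ) := by linarith only [hℓ3]
  have hkP : K - n ≤ (F.P K).m + (F.P K).K := FlatMinimizerH.le_T3 F n K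
  have hk1 : 1 ≤ K - n := by omega
  -- `ha`: the corner letter from `a = block − t`, `0 ≤ t ≤ M′ − 1`
  have ha : ∀ ν, a ν ≤ ((iterBlockOf (K - n) x₀ ν).val : ℤ) ∧ ((iterBlockOf (K - n) x₀ ν).val : ℤ) ≤ a ν + M' - 1 := by
    intro ν; rw [ha_def]; constructor <;> linarith only [ht0, htM]
  -- `hroomW` from the room row
  have hsites : (F.P K).sitesPerDir (K - n) = 2 * F.L ^ (F.m + n) := by
    show 2 * F.L ^ (F.m + K - (K - n)) = _
    congr 2; omega
  have hroomW : 2 * ((F.P K).L ^ (K - n) * (M' + 1) + (ρ + M + L + S) * gs (F.P K).L (K - n)) ≤ (F.P K).sitesPerDir 0 := by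
    refine room_of_level_k (P := F.P K) hkP ?_
    rw [hsites]; omega
  -- the master window and the letter `s′ := n′·ε₀`, `n′ := ρ′+M′+1`
  set n' : ℝ := ((ρ + M + L + S : ℕ) : ℝ) + (M' : ℝ) + 1 with hn'
  have hρr0 : (0 : ℝ) ≤ ((ρ + M + L + S : ℕ) : ℝ) := Nat.cast_nonneg _
  have hMr1 : (1 : ℝ) ≤ (M' : ℝ) := by exact_mod_cast hM'
  have hn1 : 1 ≤ n' := by rw [hn']; linarith only [hρr0, hMr1]
  have hn0 : 0 ≤ n' := by linarith only [hn1]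
  have hMw := master_of_hw (ℓ := (L : ℝ)) (by exact_mod_cast (le_trans (by norm_num) hL3 : 1 ≤ L)) hB₀ hB₀'H hB₂' hBG hBR hcB9 hn1 hε₀.le hw
  rw [← hLr] at hMw
  have hX1 : 1 ≤ 1 + B₀ + B₀⁻¹ := by have := (inv_pos.2 hB₀).le; linarith only [this, hB₀.le]
  set s' : ℝ := n' * ε₀ with hs'
  have hs'0 : 0 ≤ s' := by rw [hs']; positivity
  have hS := small_of_master hX1 hn1 hs'0 hMw
  have hSX := smallX_of_master hn1 hs'0 hMw
  have hεs : ε₀ ≤ s' := by rw [hs']; exact le_mul_of_one_le_left hε₀.le hn1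
  have hs'21 : 10 ^ 21 * s' ≤ 1 := by
    have := mono_le_one hℓ1 hs'0 hS (a := 10 ^ 21) (j := 0) (by norm_num) (by norm_num)
    rw [pow_zero, mul_one] at this; exact this
  -- the knit's eight ε₀-windows + `hA` at `d = 3` (✓`knit_windows`, ✓`window_A`)
  obtain ⟨hε7, hδw, hRw, hσw, hα3, hα2, hw1, hw2⟩ := knit_windows (F.P K).d (F.P K).L hd3 hL3P hε₀.le hεs hS
  have hA := window_A_knit (F.P K).d (F.P K).L hd3 hL3P
  -- the remainder `R` in the master window (✓`R_small` at the literal `3`, transported along `(F.P K).d = 3`)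
  have hR0 : 0 ≤ 240 * (C2 (F.P K).d + 40000 * (((F.P K).d : ℝ) + 2) ^ 2) *
      (((2 * ((F.P K).d * (F.P K).L) + 1) * ((F.P K).d * ((F.P K).L - 1) + (F.P K).L) : ℕ) : ℝ) ^ 2 * ε₀ ^ 2 := by
    rw [hd3]; exact (R_small (F.P K).L hL1P hε₀.le hεs hn1 le_rfl hS).1
  have hRs : 240 * (C2 (F.P K).d + 40000 * (((F.P K).d : ℝ) + 2) ^ 2) *
      (((2 * ((F.P K).d * (F.P K).L) + 1) * ((F.P K).d * ((F.P K).L - 1) + (F.P K).L) : ℕ) : ℝ) ^ 2 * ε₀ ^ 2 ≤ s' := by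
    rw [hd3]; exact (R_small (F.P K).L hL1P hε₀.le hεs hn1 le_rfl hS).2.1
  have hnR : n' * (240 * (C2 (F.P K).d + 40000 * (((F.P K).d : ℝ) + 2) ^ 2) *
      (((2 * ((F.P K).d * (F.P K).L) + 1) * ((F.P K).d * ((F.P K).L - 1) + (F.P K).L) : ℕ) : ℝ) ^ 2 * ε₀ ^ 2) ≤ s' := by
    rw [hd3]; exact (R_small (F.P K).L hL1P hε₀.le hεs hn1 le_rfl hS).2.2.1
  have hn2R : n' ^ 2 * (240 * (C2 (F.P K).d + 40000 * (((F.P K).d : ℝ) + 2) ^ 2) *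
      (((2 * ((F.P K).d * (F.P K).L) + 1) * ((F.P K).d * ((F.P K).L - 1) + (F.P K).L) : ℕ) : ℝ) ^ 2 * ε₀ ^ 2) ≤ s' / 10 ^ 9 := by
    rw [hd3]; exact (R_small (F.P K).L hL1P hε₀.le hεs hn1 le_rfl hS).2.2.2
  set R : ℝ := 240 * (C2 (F.P K).d + 40000 * (((F.P K).d : ℝ) + 2) ^ 2) *
      (((2 * ((F.P K).d * (F.P K).L) + 1) * ((F.P K).d * ((F.P K).L - 1) + (F.P K).L) : ℕ) : ℝ) ^ 2 * ε₀ ^ 2 with hRdef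
  -- the tube letter `s = (198 + 12((M′−1)+4ρ′))·ε₀ ≤ 258·s′`
  have hs0 : 0 ≤ s := by
    rw [hs]; have : (0 : ℝ) ≤ 198 + 12 * (((M' : ℝ) - 1) + 4 * ((ρ + M + L + S : ℕ) : ℝ)) := by linarith only [hρr0, hMr1]
    exact mul_nonneg this hε₀.le
  have hs258 : s ≤ 258 * s' := by
    rw [hs, hs', hn']
    have h1 : 198 + 12 * (((M' : ℝ) - 1) + 4 * ((ρ + M + L + S : ℕ) : ℝ)) ≤ 258 * (((ρ + M + L + S : ℕ) : ℝ) + (M' : ℝ) + 1) := by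
      linarith only [hρr0, hMr1]
    have h2 := mul_le_mul_of_nonneg_right h1 hε₀.le
    linarith only [h2]
  -- ℓ′ = 5L, dd = 3(L−1) ≤ 3L (casts)
  have hℓ' : ((((F.P K).d + 2) * (F.P K).L : ℕ) : ℝ) = 5 * ((F.P K).L : ℝ) := by rw [hd3]; push_cast; ring
  have hdd0 : (0 : ℝ) ≤ ((((F.P K).d * ((F.P K).L - 1)) : ℕ) : ℝ) := Nat.cast_nonneg _
  have hdd : ((((F.P K).d * ((F.P K).L - 1)) : ℕ) : ℝ) ≤ 3 * ((F.P K).L : ℝ) := by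
    rw [hd3]; push_cast [Nat.cast_sub hL1P]; linarith only [hℓ0]
  -- the stair windows `hpw hsw hθw`
  have hpw : ((((F.P K).d * ((F.P K).L - 1) : ℕ) : ℝ)) * (4 * ε₀) ≤ 1 / 200 := by
    have h1 : ((((F.P K).d * ((F.P K).L - 1) : ℕ) : ℝ)) * (4 * ε₀) ≤ 3 * ((F.P K).L : ℝ) * (4 * s') :=
      mul_le_mul hdd (mul_le_mul_of_nonneg_left hεs (by norm_num)) (by positivity) (by positivity)
    have m := mono_le_one hℓ1 hs'0 hS (a := 2400) (j := 1) (by norm_num) (by norm_num)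
    rw [pow_one] at m; linarith only [h1, m]
  have hsw : s ≤ 1 / 200 := by linarith only [hs258, hs'21]
  have hθw : 12 * ((((F.P K).d + 2) * (F.P K).L : ℕ) : ℝ) * (s + 102 / 100 * R) ≤ 1 := by
    rw [hℓ']
    have h1 : s + 102 / 100 * R ≤ 260 * s' := by linarith only [hs258, hRs, hs'0]
    have h2 := mul_le_mul_of_nonneg_left h1 (by positivity : (0 : ℝ) ≤ 12 * (5 * ((F.P K).L : ℝ)))
    have m := mono_le_one hℓ1 hs'0 hS (a := 15600) (j := 1) (by norm_num) (by norm_num)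
    rw [pow_one] at m; linarith only [h2, m]
  -- the ω-row's windows at `αω := ε₀`
  have hC0 : 0 ≤ C0 (F.P K).d := (B7Prop2Explicit.C0_pos _).le
  have hαω3 : C0 (F.P K).d * ε₀ ≤ 1 / 3 := by
    have : C0 (F.P K).d * ε₀ ≤ C0 (F.P K).d * (2 * ε₀) := mul_le_mul_of_nonneg_left (by linarith only [hε₀.le]) hC0
    linarith only [this, hα3]
  have hαω4 : 4 * ε₀ ≤ c2' (F.P K).d (F.P K).L := by linarith only [hα2]
  have hαωexp : Real.exp (4 * (800 * (((F.P K).d : ℝ) + 1) ^ 2 * (((F.P K).d : ℝ) + 4)) * ε₀) ≤ 11 / 10 := by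
    rw [hd3r]
    have hx0 : 0 ≤ 4 * (800 * ((3 : ℝ) + 1) ^ 2 * ((3 : ℝ) + 4)) * ε₀ := by positivity
    have hx : 4 * (800 * ((3 : ℝ) + 1) ^ 2 * ((3 : ℝ) + 4)) * ε₀ ≤ 1 / 20 := by
      have m := mono_le_one hℓ1 hs'0 hS (a := 7168000) (j := 0) (by norm_num) (by norm_num)
      rw [pow_zero, mul_one] at m; nlinarith only [m, hεs, hε₀.le]
    have h := Real.abs_exp_sub_one_le (x := 4 * (800 * ((3 : ℝ) + 1) ^ 2 * ((3 : ℝ) + 4)) * ε₀) (by rw [abs_of_nonneg hx0]; linarith only [hx])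
    rw [abs_of_nonneg hx0] at h
    have h2 : Real.exp (4 * (800 * ((3 : ℝ) + 1) ^ 2 * ((3 : ℝ) + 4)) * ε₀) - 1 ≤ 2 * (4 * (800 * ((3 : ℝ) + 1) ^ 2 * ((3 : ℝ) + 4)) * ε₀) :=
      (le_abs_self _).trans h
    have h3 : 2 * (4 * (800 * ((3 : ℝ) + 1) ^ 2 * ((3 : ℝ) + 4)) * ε₀) ≤ 1 / 10 := by linarith only [hx]
    exact (sub_le_iff_le_add.mp (h2.trans h3)).trans (by norm_num)
  -- the chart guard `cσ := 2·(L·c⋆)` and the level sizes `h⋆`, `w⋆` in the master window (✓`csigma_le`, ✓`hstar_le`, ✓`wstar_le`, ✓`thetaG_le_of_sigma`)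
  have hα₁' : α₁ = 198 * s' + 27 * s' / (((F.P K).L : ℝ) * B₀) := by rw [hLr]; exact hα₁
  have hcstar' : cstar = 5 * ((F.P K).d : ℝ) * ((F.P K).L : ℝ) * B₀ * (ε₀ + α₁) := hcstar
  have hcs0 : 0 ≤ cstar := by
    rw [hcstar']
    have hα₁0 : 0 ≤ α₁ := by rw [hα₁']; positivity
    positivity
  have hcσ0 : (0 : ℝ) ≤ 2 * (((F.P K).L : ℝ) * cstar) := by positivity
  have hcσ := csigma_le (cσ := 2 * (((F.P K).L : ℝ) * cstar)) hd3r hℓ3 hB₀ hε₀.le hεs hα₁' hcstar' le_rfl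
  have hH := hstar_le (ℓ' := ((((F.P K).d + 2) * (F.P K).L : ℕ) : ℝ)) (dd := ((((F.P K).d * ((F.P K).L - 1)) : ℕ) : ℝ))
    hℓ1 hℓ'.le hdd0 hdd hε₀.le hεs hR0 hRs
  have hD0 : 0 ≤ ((F.P K).d : ℝ) * (((F.P K).L : ℝ) - 1) := by rw [hd3r]; nlinarith only [hℓ1]
  have hD : ((F.P K).d : ℝ) * (((F.P K).L : ℝ) - 1) ≤ 3 * ((F.P K).L : ℝ) := by rw [hd3r]; linarith only [hℓ1]
  have hC : 256 * (((F.P K).d : ℝ) + 1) * (((F.P K).d : ℝ) + 4) ≤ 7168 := by rw [hd3r]; norm_num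
  have hC0' : 0 ≤ 256 * (((F.P K).d : ℝ) + 1) * (((F.P K).d : ℝ) + 4) := by positivity
  have hG : 64 * ((F.P K).d : ℝ) ≤ 192 := by rw [hd3r]; norm_num
  have hG0 : 0 ≤ 64 * ((F.P K).d : ℝ) := by positivity
  have hW := wstar_le hℓ3 hD0 hD hC0' hC hG0 hG hε₀.le hεs hcσ0 hcσ hX1 hSX
  have hW0 : 0 ≤ (((F.P K).d : ℝ) * (((F.P K).L : ℝ) - 1)) * (256 * (((F.P K).d : ℝ) + 1) * (((F.P K).d : ℝ) + 4) * (2 * ε₀) + 2 * (((F.P K).L : ℝ) * cstar))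
      + 2 * (64 * ((F.P K).d : ℝ) * (2 * (((F.P K).L : ℝ) * cstar))) + (64 * ((F.P K).d : ℝ) * (2 * (((F.P K).L : ℝ) * cstar))) ^ 2
      + (2 * (64 * ((F.P K).d : ℝ) * (2 * (((F.P K).L : ℝ) * cstar))) + (64 * ((F.P K).d : ℝ) * (2 * (((F.P K).L : ℝ) * cstar))) ^ 2) *
        ((((F.P K).d : ℝ) * (((F.P K).L : ℝ) - 1)) * (256 * (((F.P K).d : ℝ) + 1) * (((F.P K).d : ℝ) + 4) * (2 * ε₀) + 2 * (((F.P K).L : ℝ) * cstar))) := by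
    have := hD0; positivity
  obtain ⟨-, hθ38, hwin, hsmall, hH64, hW600⟩ := thetaG_le_of_sigma hℓ3 hX1 hs'0 hW0 hH hW hSX
  -- the door's numeric rows `hρk1`, `hθb` (✓`theta_budget` with the closure's `Cθ = 4`)
  have hρk1 : ((F.P K).d : ℝ) * (M' + (ρ + M + L + S : ℕ)) * R ≤ 1 / 8 := by
    rw [hd3r]
    have h1 : ((M' : ℝ) + ((ρ + M + L + S : ℕ) : ℝ)) * R ≤ n' * R := by
      have : (M' : ℝ) + ((ρ + M + L + S : ℕ) : ℝ) ≤ n' := by rw [hn']; linarith only []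
      exact mul_le_mul_of_nonneg_right this hR0
    nlinarith only [h1, hnR, hs'21]
  have hε₁1 : ε₁ ≤ 1 := by
    have h4 : 4 * ε₁ ≤ Cr * ε₁ := by nlinarith only [hCr4, hε₁]
    linarith only [h4, hCrε, hεs, hs'21]
  have hbud := (theta_budget (d := ((F.P K).d : ℝ)) (L := ((F.P K).L : ℝ)) (R := R) hd3r hℓ3 hB₀ hMr1 hρr0 hε₀.le hε₁ hCrε (le_refl (4 : ℝ))
    hCθ hα₁' hR0 hn2R hS hθ38).1
  -- px15 g4's member knit σ ✓`HalvingHStokesRow.hStokes_holds` at `cσ := 2·((F.P K).L·cstar)`, `αω := ε₀`, `θb := d·L·α₁∕8`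
  exact hStokes_holds F hnK x₀ hM' ha hroomW U (2 * (((F.P K).L : ℝ) * cstar)) hε₀ hcσ0 V hU hε₁.le hε₁1 hV
    hε7 hδw hRw hσw hα3 hα2 hw1 hw2 hA hpw hs0 hsw hθw hε₀ hαω3 hαω4 hαωexp
    (by linarith only [hH64]) (by linarith only [hW600]) hwin hsmall hρk1 hbud

end Summit.QuantumFields.YangMills.Theorems.HalvingHStokesRowClosure
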